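import Literature.MathematicalPhysics.QuantumFieldTheory.Balaban1983to89.B9CoReadingCoordsInputS
import Literature.MathematicalPhysics.QuantumFieldTheory.Balaban1983to89.B9Thm34Ext
import Literature.MathematicalPhysics.QuantumFieldTheory.Balaban1983to89.B11SectG

/-!
# `Balaban1983to89.B9StateAprioriL1` — the bootstrap's A-PRIORI CONSTANT MAJORANT out of an ℓ¹-CONTROLLED source class, and the ℓ¹ control of
# the two input norms `bHK` (bond carrier) ∕ `bHS` (site carrier) of the N06 certificate's pins

T. Bałaban, *Propagators and renormalization transformations for lattice gauge theories. II*, Commun. Math. Phys. **96** (1984) 223–250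
[`Balaban1984PropagatorsII`, "[4]"], (2.66) p. 234 (*"the representation (2.50) is convergent in the norms"* — on a finite lattice every
operator is bounded between any two of the local norms); T. Bałaban, *Propagators for lattice gauge theories in a background field*, Commun.
Math. Phys. **99** (1985) 389–434 [`Balaban1985BackgroundPropagators`, "B9"], (3.39)–(3.41) p. 397, (3.44) p. 398 (*"supp λ ⊂ Δ̃(y′)"*).

statement-level bookkeeping with citation tags; nothing here is a claim about the Yang–Mills mass gap

WHY THIS FILE (cell `pub-ymgap`, node N06 [B9], FLAG №8 (U8); seat dag-n06-d g18, LOCATED-S1).  The resolvent bootstrap of Theorem 3.12 ∕ 3.13 over a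
regular state class (`B9Thm312WholeStepRegular.hasMaj_right_of_stepS`) needs an A-PRIORI constant majorant `hap : HasMaj b₀ 𝔖 T (fun _ _ => M₀)` of the
right entry out of the input class `b₀`.  `B9Thm312WholeSeriesRegular.exists_hasMaj_const_of_dom_src` produces it from a DOMINATION of the sharp block sup
class by `b₀` that includes the localisation transfer `b₀.IsLoc y μ → (ofBlocks blk).IsLoc y μ` — but the certificate's input norms
`B9CoReadingCoordsInput.bHK` ∕ `B9CoReadingCoordsInputS.bHS` are CLASS-localised (a localised vector vanishes off the carrier CLASS of `y`), the sharp sup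
class is FIBRE-localised, and the transfer is refutable (`B9Letters313IMBLocObstruction.not_isLoc_bHK_imp_ofBlocks`).  What the a-priori majorant
really needs is only that a localised input's ℓ¹ size is controlled by its norm.  THIS FILE: §1 ★ `exists_hasMaj_const_of_l1_src` — if
`b₀.IsLoc y μ → Σ_v |μ v| ≤ Λ_X·b₀.loc y μ` and `𝔖.loc y F ≤ Λ·Σ_x |F x|`, then EVERY linear `T` has a constant majorant `b₀ → 𝔖`
(`M₀ := Λ·Λ_X·Σ_{x,v} |T e_v x|`); §2 ★ `sum_abs_le_loc_bHK_of_isLoc`, ★ `sum_abs_le_loc_bHS_of_isLoc` — the two input norms ARE ℓ¹-controlled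
(`Λ_X := card` of the carrier: a class-localised vector has every entry below the class-restricted sup `supK ≤ loc`).

HONEST SCOPE.  Finite-dimensional bookkeeping; nothing of [B9]∕[4] asserted; no certificate edit; COUNT-NEUTRAL; N06 NOT discharged; one finite lattice —
nothing continuum ∕ OS ∕ mass gap.  Cell `pub-ymgap` (HUMAN RULING D-0062), Track A node N06 [B9], 2026-08-29.  NEW file; nothing landed is modified.
RELATED, NOT DUPLICATED: `B9Thm312WholeStepRegular.exists_hasMaj_const_of_dom`, `B9Thm312WholeSeriesRegular.exists_hasMaj_const_of_dom_src` (the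
fibre-domination route; USED where its hypothesis holds), `B9CoReadingCoordsInput(S)` (the norms, BY NAME).
-/

namespace Literature.MathematicalPhysics.QuantumFieldTheory.Balaban1983to89.B9StateAprioriL1

open B9Thm34Ext (toB6)
open B11SectG (BlockNorm HasMaj)
open B6KLevelCensusIndexV1 (KIdx)
open B9GeoNormsKLevelV1 (geo9K)
open B9CoRealizesRelAtLetters (RelB)
open B9CoReadingCoords (XBK)
open B9CoReadingCoordsS (XSK)
open B9CoReadingCoordsInput (bHK supK holK restrK supK_nonneg holK_nonneg)
open B9CoReadingCoordsInputS (bHS supS holS restrS supS_nonneg holS_nonneg)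
open Node00 (SiteY FBondY IBondY)

noncomputable section

/-! ## §1 The a-priori constant majorant out of an ℓ¹-controlled source class -/

section Generic

variable {g : B9.Geometry} [Fintype g.Site] {R₀ : ℝ} {H₀ : Prop} {X V : Type} [Fintype X] [Fintype V] [DecidableEq V]

/-- ★ **EVERY LINEAR MAP HAS A CONSTANT MAJORANT OUT OF AN ℓ¹-CONTROLLED CLASS INTO AN ℓ¹-DOMINATED CLASS** (the finite-lattice remark behind [4] (2.66)):
if a `b₀`-localised vector has `Σ_v |μ v| ≤ Λ_X·‖μ‖_{b₀,y}` and `‖F‖_{𝔖,y} ≤ Λ·Σ_x |F x|`, then `HasMaj b₀ 𝔖 T (fun _ _ => M₀)` with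
`M₀ = Λ·Λ_X·Σ_x Σ_v |T e_v x|`. [cite: Balaban1984PropagatorsII, (2.66) p.234 (bookkeeping); Balaban1985BackgroundPropagators, (3.39)–(3.41) p.397] -/
theorem exists_hasMaj_const_of_l1_src {b₀ : BlockNorm (toB6 g R₀ H₀) (V → ℝ)} {𝔖 : BlockNorm (toB6 g R₀ H₀) (X → ℝ)} {ΛX Λ : ℝ}
    (hΛX : 0 ≤ ΛX) (hsrc : ∀ (y : g.Site) (μ : V → ℝ), b₀.IsLoc y μ → ∑ v : V, |μ v| ≤ ΛX * b₀.loc y μ)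
    (hΛ : 0 ≤ Λ) (hdom : ∀ (y : g.Site) (F : X → ℝ), 𝔖.loc y F ≤ Λ * ∑ x : X, |F x|) (T : (V → ℝ) →ₗ[ℝ] (X → ℝ)) :
    ∃ M₀ : ℝ, 0 ≤ M₀ ∧ HasMaj b₀ 𝔖 T (fun _ _ => M₀) := by
  classical
  -- the coordinate vectors and the ℓ¹ → ℓ¹ size of `T`
  set e : V → (V → ℝ) := fun v w => if v = w then 1 else 0 with he
  set C : ℝ := ∑ x : X, ∑ v : V, |T (e v) x| with hC
  have hC0 : 0 ≤ C := Finset.sum_nonneg fun x _ => Finset.sum_nonneg fun v _ => abs_nonneg _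
  refine ⟨Λ * C * ΛX, mul_nonneg (mul_nonneg hΛ hC0) hΛX, fun y' μ hμ y => ?_⟩
  set S : ℝ := ∑ v : V, |μ v| with hS
  have hS0 : 0 ≤ S := Finset.sum_nonneg fun v _ => abs_nonneg _
  have hSv : ∀ v : V, |μ v| ≤ S := fun v => Finset.single_le_sum (fun w _ => abs_nonneg (μ w)) (Finset.mem_univ v)
  -- `Tμ = Σ_v μ_v · T e_v`, entrywise
  have hT : ∀ x : X, |T μ x| ≤ ∑ v : V, S * |T (e v) x| := fun x => by
    have h1 : T μ x = ∑ v : V, μ v * T (e v) x := by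
      rw [LinearMap.pi_apply_eq_sum_univ T μ, Finset.sum_apply]
      simp only [Pi.smul_apply, smul_eq_mul, he]
    rw [h1]
    refine (Finset.abs_sum_le_sum_abs _ _).trans (Finset.sum_le_sum fun v _ => ?_)
    rw [abs_mul]
    exact mul_le_mul_of_nonneg_right (hSv v) (abs_nonneg _)
  have hsum : ∑ x : X, |T μ x| ≤ S * C := by
    calc ∑ x : X, |T μ x| ≤ ∑ x : X, ∑ v : V, S * |T (e v) x| := Finset.sum_le_sum fun x _ => hT x
      _ = S * C := by rw [hC, Finset.mul_sum]; refine Finset.sum_congr rfl fun x _ => ?_; rw [Finset.mul_sum]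
  calc 𝔖.loc y (T μ) ≤ Λ * ∑ x : X, |T μ x| := hdom y (T μ)
    _ ≤ Λ * (S * C) := mul_le_mul_of_nonneg_left hsum hΛ
    _ ≤ Λ * ((ΛX * b₀.loc y' μ) * C) := mul_le_mul_of_nonneg_left (mul_le_mul_of_nonneg_right (hsrc y' μ hμ) hC0) hΛ
    _ = Λ * C * ΛX * b₀.loc y' μ := by ring

end Generic

/-! ## §2 The two input norms of the certificate's pins are ℓ¹-controlled -/

section Pins

variable {d ℓ : ℕ} {hd : 1 ≤ d + 1} {hL : Odd (ℓ + 1) ∧ 1 < ℓ + 1} {b₀ b₁ : ℝ}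
variable {κ : Type} [Fintype κ]
variable (i : KIdx d ℓ hd hL b₀ b₁) [Fintype (geo9K i).Site] [DecidableRel (RelB i)]

/-- ★ **A CLASS-LOCALISED BOND VECTOR HAS ℓ¹ SIZE ≤ card·‖·‖_{bHK}**: `(bHK bI ε).IsLoc y μ` (μ vanishes off the carrier class of `y`) gives `|μ q| ≤ supK y μ ≤
(bHK bI ε).loc y μ` for every carrier point `q`, hence `Σ_q |μ q| ≤ card(XBK)·(bHK bI ε).loc y μ`.
[cite: Balaban1985BackgroundPropagators, (3.39)–(3.41) p.397 + (3.44) p.398 (bookkeeping); Balaban1984PropagatorsII, (2.51)–(2.52) p.232] -/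
theorem sum_abs_le_loc_bHK_of_isLoc (bI : FBondY i → IBondY i) {R : ℝ} {H : Prop} (ε : ℝ) (y : IBondY i) (μ : XBK κ i → ℝ)
    (hμ : (bHK (κ := κ) i bI ε (R := R) (H := H)).IsLoc y μ) :
    ∑ q : XBK κ i, |μ q| ≤ (Fintype.card (XBK κ i) : ℝ) * (bHK (κ := κ) i bI ε (R := R) (H := H)).loc y μ := by
  classical
  have hq : ∀ q : XBK κ i, |μ q| ≤ (bHK (κ := κ) i bI ε (R := R) (H := H)).loc y μ := fun q => by
    have hsup : |μ q| ≤ supK i bI y μ := by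
      by_cases h : RelB i (bI q.1) y
      · have e1 : |μ q| = |restrK i bI y μ q| := by simp only [restrK, h, if_true]
        rw [e1]
        exact le_ciSup (f := fun p : XBK κ i => |restrK i bI y μ p|) (Set.finite_range _).bddAbove q
      · rw [hμ q h, abs_zero]; exact supK_nonneg i bI y μ
    exact hsup.trans (le_add_of_nonneg_right (holK_nonneg i bI ε y μ))
  calc ∑ q : XBK κ i, |μ q| ≤ ∑ _q : XBK κ i, (bHK (κ := κ) i bI ε (R := R) (H := H)).loc y μ := Finset.sum_le_sum fun q _ => hq q
    _ = (Fintype.card (XBK κ i) : ℝ) * (bHK (κ := κ) i bI ε (R := R) (H := H)).loc y μ := by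
        rw [Finset.sum_const, Finset.card_univ, nsmul_eq_mul]

/-- ★ the site twin: `(bHS sI ε).IsLoc y μ` gives `Σ_p |μ p| ≤ card(XSK)·(bHS sI ε).loc y μ`.
[cite: Balaban1985BackgroundPropagators, (3.39)–(3.41) p.397 + (3.44) p.398 (bookkeeping); Balaban1984PropagatorsII, (2.67) p.234] -/
theorem sum_abs_le_loc_bHS_of_isLoc (sI : SiteY i → IBondY i) {R : ℝ} {H : Prop} (ε : ℝ) (y : IBondY i) (μ : XSK κ i → ℝ)
    (hμ : (bHS (κ := κ) i sI ε (R := R) (H := H)).IsLoc y μ) :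
    ∑ p : XSK κ i, |μ p| ≤ (Fintype.card (XSK κ i) : ℝ) * (bHS (κ := κ) i sI ε (R := R) (H := H)).loc y μ := by
  classical
  have hq : ∀ p : XSK κ i, |μ p| ≤ (bHS (κ := κ) i sI ε (R := R) (H := H)).loc y μ := fun p => by
    have hsup : |μ p| ≤ supS i sI y μ := by
      by_cases h : RelB i (sI p.1) y
      · have e1 : |μ p| = |restrS i sI y μ p| := by simp only [restrS, h, if_true]
        rw [e1]
        exact le_ciSup (f := fun p' : XSK κ i => |restrS i sI y μ p'|) (Set.finite_range _).bddAbove p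
      · rw [hμ p h, abs_zero]; exact supS_nonneg i sI y μ
    exact hsup.trans (le_add_of_nonneg_right (holS_nonneg i sI ε y μ))
  calc ∑ p : XSK κ i, |μ p| ≤ ∑ _p : XSK κ i, (bHS (κ := κ) i sI ε (R := R) (H := H)).loc y μ := Finset.sum_le_sum fun p _ => hq p
    _ = (Fintype.card (XSK κ i) : ℝ) * (bHS (κ := κ) i sI ε (R := R) (H := H)).loc y μ := by
        rw [Finset.sum_const, Finset.card_univ, nsmul_eq_mul]

/-- the `∃ Λ_X`-form the repaired leaf binder `hdomX` displays, at the bond input pin. [cite: Balaban1985BackgroundPropagators, (3.44) p.398 (bookkeeping)] -/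
theorem exists_l1_control_bHK (bI : FBondY i → IBondY i) {R : ℝ} {H : Prop} (ε : ℝ) :
    ∃ ΛX : ℝ, 0 ≤ ΛX ∧ ∀ (y : IBondY i) (μ : XBK κ i → ℝ), (bHK (κ := κ) i bI ε (R := R) (H := H)).IsLoc y μ →
      ∑ q : XBK κ i, |μ q| ≤ ΛX * (bHK (κ := κ) i bI ε (R := R) (H := H)).loc y μ :=
  ⟨Fintype.card (XBK κ i), Nat.cast_nonneg _, fun y μ hμ => sum_abs_le_loc_bHK_of_isLoc i bI ε y μ hμ⟩

/-- the same at the site input pin. [cite: Balaban1985BackgroundPropagators, (3.44) p.398 (bookkeeping)] -/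
theorem exists_l1_control_bHS (sI : SiteY i → IBondY i) {R : ℝ} {H : Prop} (ε : ℝ) :
    ∃ ΛW : ℝ, 0 ≤ ΛW ∧ ∀ (y : IBondY i) (μ : XSK κ i → ℝ), (bHS (κ := κ) i sI ε (R := R) (H := H)).IsLoc y μ →
      ∑ p : XSK κ i, |μ p| ≤ ΛW * (bHS (κ := κ) i sI ε (R := R) (H := H)).loc y μ :=
  ⟨Fintype.card (XSK κ i), Nat.cast_nonneg _, fun y μ hμ => sum_abs_le_loc_bHS_of_isLoc i sI ε y μ hμ⟩

end Pins

end

end Literature.MathematicalPhysics.QuantumFieldTheory.Balaban1983to89.B9StateAprioriL1
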